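import Mathlib

/-!
# Deterministic skeleton of the sample-stream von Neumann–Ulam estimator (cell pub-qadeq, DEQ-A09)

Topic `Literature/Computability/QuantumAlgorithms` (dequantization companions; namespace follows the path, grouping
sub-namespace `SampleStreamNeumann`).  Every declaration below is elementary and PROVED (`[folklore]`: truncated Neumann /
Richardson iteration, e.g. Forsythe–Leibler 1950, doi:10.1090/s0025-5718-1950-0038138-x, and the von Neumann–Ulam scheme);
no named fact, no claim-tagged statement of the adjudicated preprint is introduced.

HONEST FRAMING: instance-level adjudication of a specific advantage claim (arXiv:2604.07639v1, Task F.1,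
linear-system task); no claim about BQP vs BPP or the summit.

Companion to `run/shared/lean/pub/pub-qadeq/pub-qadeq-deq-1/DEQ-A09.md`, Theorem A (a classical one-pass
streaming estimator for `θ = xᵀ M̄ x / xᵀ x`, `x = A⁻¹ b`, from i.i.d. samples of the nonzero entries of `A`
and of the entries of `b`).  The probabilistic half of that theorem (Wald identity for renewal blocks,
second moments, median of means) is NOT formalised here.  This file records, with proofs, the three
deterministic facts the theorem uses:

* `mul_mul_truncNeumannSum` : in any ring, `a * a * ∑_{t<D} (1 - a*a)^t = 1 - (1 - a*a)^D`; hence the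
  truncated odd Neumann series `p_D(a) = a * ∑_{t<D} (1 - a²)^t` satisfies `a * p_D(a) = 1 - (1 - a²)^D`
  (Lemma 4.1 of DEQ-A09; applies verbatim to square matrices);
* `truncation_decay`, `truncation_budget` : `κ (1 - 1/κ²)^D ≤ κ e^{-D/κ²} ≤ ε/8` once
  `κ² log(8κ/ε) ≤ D` (the choice `D = ⌈κ² ln(8κ/ε)⌉`);
* `ratio_estimate` : the ratio lemma (Lemma 4.2(c)): if `3/4 ≤ d`, `|n| ≤ d`, `|n' - n| ≤ ε₁`,
  `|d' - d| ≤ ε₁`, `0 ≤ ε₁ ≤ 1/8` then `|n'/d' - n/d| ≤ 4 ε₁`.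

No named Literature fact is introduced; everything below is proved.
-/

namespace Literature.Computability.QuantumAlgorithms

namespace SampleStreamNeumann

open Finset

/-- The truncated Neumann sum `∑_{t<D} (1 - a*a)^t`. [folklore] -/
def truncNeumannSum {R : Type*} [Ring R] (a : R) (D : ℕ) : R :=
  ∑ t ∈ range D, (1 - a * a) ^ t

/-- The truncated odd Neumann series `p_D(a) = a * ∑_{t<D} (1 - a*a)^t` (an approximate inverse of `a`). [folklore] -/
def truncNeumann {R : Type*} [Ring R] (a : R) (D : ℕ) : R :=
  a * truncNeumannSum a D

/-- Telescoping identity behind Lemma 4.1: `a * a * ∑_{t<D} (1 - a a)^t = 1 - (1 - a a)^D`, in any ring. [folklore] -/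
theorem mul_mul_truncNeumannSum {R : Type*} [Ring R] (a : R) (D : ℕ) :
    a * a * truncNeumannSum a D = 1 - (1 - a * a) ^ D := by
  unfold truncNeumannSum
  set x : R := 1 - a * a with hx
  have hc : Commute x (∑ t ∈ range D, x ^ t) :=
    Commute.sum_right _ _ _ (fun i _ => (Commute.refl x).pow_right i)
  have h := geom_sum_mul x D
  have haa : a * a = 1 - x := by rw [hx]; abel
  calc a * a * ∑ t ∈ range D, x ^ t
      = (1 - x) * ∑ t ∈ range D, x ^ t := by rw [haa]
    _ = (∑ t ∈ range D, x ^ t) - x * ∑ t ∈ range D, x ^ t := by rw [sub_mul, one_mul]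
    _ = (∑ t ∈ range D, x ^ t) - (∑ t ∈ range D, x ^ t) * x := by rw [hc.eq]
    _ = -((∑ t ∈ range D, x ^ t) * (x - 1)) := by noncomm_ring
    _ = 1 - x ^ D := by rw [h]; abel

/-- `a * p_D(a) = 1 - (1 - a a)^D`. [folklore] -/
theorem mul_truncNeumann {R : Type*} [Ring R] (a : R) (D : ℕ) :
    a * truncNeumann a D = 1 - (1 - a * a) ^ D := by
  unfold truncNeumann
  rw [← mul_assoc]
  exact mul_mul_truncNeumannSum a D

/-- Matrix instance of the telescoping identity (the form used for `x̃ = p_D(A) b`). [folklore] -/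
theorem matrix_mul_truncNeumann {n : Type*} [Fintype n] [DecidableEq n]
    (A : Matrix n n ℝ) (D : ℕ) :
    A * truncNeumann A D = 1 - (1 - A * A) ^ D :=
  mul_truncNeumann A D

/-- If `a` is a unit, the truncation residual is exactly `a⁻¹ (1 - a a)^D`:
`p_D(a) = a⁻¹ - a⁻¹ (1 - a a)^D`. [folklore] -/
theorem truncNeumann_eq_of_isUnit {R : Type*} [Ring R] (D : ℕ) (u : Rˣ) :
    truncNeumann (u : R) D = (↑u⁻¹ : R) - (↑u⁻¹ : R) * (1 - (u : R) * (u : R)) ^ D := by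
  have h := mul_truncNeumann (u : R) D
  have e : truncNeumann (u : R) D = (↑u⁻¹ : R) * ((u : R) * truncNeumann (u : R) D) := by
    rw [← mul_assoc, Units.inv_mul, one_mul]
  rw [e, h, mul_sub, mul_one]

/-- Decay of the truncation error (Lemma 4.1): for `1 ≤ κ`, `κ (1 - 1/κ²)^D ≤ κ exp(-D/κ²)`. [folklore] -/
theorem truncation_decay (κ : ℝ) (hκ : 1 ≤ κ) (D : ℕ) :
    κ * (1 - 1 / κ ^ 2) ^ D ≤ κ * Real.exp (-(D : ℝ) / κ ^ 2) := by
  have hκ0 : 0 ≤ κ := le_trans zero_le_one hκ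
  have hk2 : 1 ≤ κ ^ 2 := by nlinarith
  have hu0 : 0 ≤ 1 - 1 / κ ^ 2 := by
    rw [sub_nonneg, div_le_one (by positivity)]; exact hk2
  have hle : 1 - 1 / κ ^ 2 ≤ Real.exp (-(1 / κ ^ 2)) := by
    have := Real.add_one_le_exp (-(1 / κ ^ 2))
    linarith
  have h1 : (1 - 1 / κ ^ 2) ^ D ≤ (Real.exp (-(1 / κ ^ 2))) ^ D :=
    pow_le_pow_left₀ hu0 hle D
  have h2 : (Real.exp (-(1 / κ ^ 2))) ^ D = Real.exp (-(D : ℝ) / κ ^ 2) := by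
    rw [← Real.exp_nat_mul]; congr 1; ring
  calc κ * (1 - 1 / κ ^ 2) ^ D ≤ κ * (Real.exp (-(1 / κ ^ 2))) ^ D :=
        mul_le_mul_of_nonneg_left h1 hκ0
    _ = κ * Real.exp (-(D : ℝ) / κ ^ 2) := by rw [h2]

/-- The degree budget (choice `D ≥ κ² log(8κ/ε)`): then `κ exp(-D/κ²) ≤ ε/8`. [folklore] -/
theorem truncation_budget (κ ε : ℝ) (hκ : 1 ≤ κ) (hε : 0 < ε) (D : ℕ)
    (hD : κ ^ 2 * Real.log (8 * κ / ε) ≤ D) :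
    κ * Real.exp (-(D : ℝ) / κ ^ 2) ≤ ε / 8 := by
  have hκ0 : 0 < κ := lt_of_lt_of_le zero_lt_one hκ
  have hk2 : 0 < κ ^ 2 := by positivity
  have hy : 0 < 8 * κ / ε := by positivity
  have hle : -(D : ℝ) / κ ^ 2 ≤ -Real.log (8 * κ / ε) := by
    rw [neg_div, neg_le_neg_iff, le_div_iff₀ hk2, mul_comm]
    exact hD
  calc κ * Real.exp (-(D : ℝ) / κ ^ 2) ≤ κ * Real.exp (-Real.log (8 * κ / ε)) :=
        mul_le_mul_of_nonneg_left (Real.exp_le_exp.mpr hle) hκ0.le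
    _ = κ * (8 * κ / ε)⁻¹ := by rw [Real.exp_neg, Real.exp_log hy]
    _ = ε / 8 := by field_simp

/-- Ratio lemma (Lemma 4.2(c)): estimating a ratio `n/d` with `d ≥ 3/4`, `|n| ≤ d` from `ε₁`-accurate
estimates of numerator and denominator, `ε₁ ≤ 1/8`, costs at most a factor `4`. [folklore] -/
theorem ratio_estimate (n d n' d' ε₁ : ℝ) (hd : 3 / 4 ≤ d) (hnd : |n| ≤ d)
    (hn : |n' - n| ≤ ε₁) (hd' : |d' - d| ≤ ε₁) (hε : 0 ≤ ε₁) (hε' : ε₁ ≤ 1 / 8) :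
    |n' / d' - n / d| ≤ 4 * ε₁ := by
  have hd0 : 0 < d := by linarith
  have hd'lo : 5 / 8 ≤ d' := by
    have := (abs_le.mp hd').1
    linarith
  have hd'0 : 0 < d' := by linarith
  have hdd : 0 < d * d' := mul_pos hd0 hd'0
  have key : |n' * d - n * d'| ≤ 2 * ε₁ * d := by
    have hsplit : n' * d - n * d' = (n' - n) * d - n * (d' - d) := by ring
    rw [hsplit]
    calc |(n' - n) * d - n * (d' - d)| ≤ |(n' - n) * d| + |n * (d' - d)| := abs_sub _ _
      _ = |n' - n| * d + |n| * |d' - d| := by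
          rw [abs_mul, abs_mul, abs_of_pos hd0]
      _ ≤ ε₁ * d + d * ε₁ := by
          gcongr
      _ = 2 * ε₁ * d := by ring
  have hrepr : n' / d' - n / d = (n' * d - n * d') / (d * d') := by
    rw [div_sub_div _ _ hd'0.ne' hd0.ne']
    ring
  rw [hrepr, abs_div, abs_of_pos hdd, div_le_iff₀ hdd]
  have h5 : (1 : ℝ) / 2 ≤ d' := by linarith
  have hεd : (0 : ℝ) ≤ 4 * (ε₁ * d) := by nlinarith [mul_nonneg hε hd0.le]
  calc |n' * d - n * d'| ≤ 2 * ε₁ * d := key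
    _ = 4 * (ε₁ * d) * (1 / 2) := by ring
    _ ≤ 4 * (ε₁ * d) * d' := mul_le_mul_of_nonneg_left h5 hεd
    _ = 4 * ε₁ * (d * d') := by ring

/-- Rayleigh-quotient arithmetic behind Lemma 4.2(a)–(b), scalar form: if `‖x - x̃‖ ≤ η ‖x‖` with
`η ≤ 1/8` and `‖b‖ ≤ ‖x‖` (so `(1-η)‖x‖ ≤ ‖x̃‖`), then `‖x̃‖² / ‖b‖² ≥ 3/4` — recorded as the real
inequality used (`nx = ‖x‖`, `nxt = ‖x̃‖`, `nb = ‖b‖`). [folklore] -/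
theorem den_lower_bound (η nx nxt nb : ℝ) (hη' : η ≤ 1 / 8) (hb : 0 < nb)
    (hbx : nb ≤ nx) (hxt : (1 - η) * nx ≤ nxt) : 3 / 4 ≤ nxt ^ 2 / nb ^ 2 := by
  have h1 : (1 - η) * nb ≤ nxt := le_trans (by nlinarith) hxt
  have h78 : 7 / 8 * nb ≤ nxt := le_trans (by nlinarith) h1
  have hnxt : 0 ≤ nxt := le_trans (by positivity) h78
  rw [le_div_iff₀ (by positivity)]
  nlinarith [mul_le_mul h78 h78 (by positivity) hnxt]

end SampleStreamNeumann

end Literature.Computability.QuantumAlgorithms
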